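import Summits.BirchSwinnertonDyer.BirchSwinnertonDyer.Theorems.GenusKolyvaginAtTwoTorsionCellGenusDepthTwistEigen
import HarnessLib

/-!
# LINE 49 «full_vertex» — the Ψ-LAW, identification step: `ψ_δ` IS the Kummer cocycle of the rational twist point (memo §2 (ii))

Crux R″ `RankOneTwoTorsionResidualAtTwo` (stmt-BirchSwinnertonDyer-27478) of route GenusKolyvaginAtTwo, LINE 49
«torsion_cell_full_vertex_bsdidea1» (pen bsd-idea-1); companion of `…PsiLaw` (the Ψ-test) and sequel of
`…GenusDepthTwistEigen` (twist points are `χ_θ`-eigenvectors).  The pen's memo `psi_law.md` (2026-09-01 r1) §2 (ii):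
«with `R^{tw} := φ_δ^{−1}(R_δ)` one has `2R^{tw} = g_δ + t_δ` (a RATIONAL point of `E^{(δ)}`) and, by semilinearity,
`ρR_δ = χ_δ(ρ)·φ_δ(ρR^{tw})`, hence `ψ_δ(ρ) = φ_δ(ρR^{tw} − R^{tw})` = the Kummer cocycle of `g_δ + t_δ ∈ E^{(δ)}(ℚ)`» —
this is what makes `c_δ` (and the Ψ-test) a FIRST-DESCENT datum, computable from `Sel₂(E^{(δ)}/ℚ)` alone.

Here `φ_δ` over the big field is the tree's change of variables `u = θ` (`twistUntwist hθ`, `QuadraticTwistRank.lean`)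
read on `L`-points: the isomorphism `Φ : W^{(c)}(L) →+ W^{(1)}(L)`, `(X, Y) ↦ (X/θ², Y/θ³)`, written DEF-FREE as the
composite `congrEquiv (twistUntwist_smul_baseChange W hθ hc) ∘ VariableChange.pointEquiv (W^{(c)} ⊗ L) (twistUntwist hθ)`
and carried through the statements as a variable `Φ` with its defining equation `hΦ` (instantiate with `rfl`); the
tree's twisting map on RATIONAL points is `τ = twistMap W hθ hc = Φ ∘ ι` (`twistMap_eq_twistMapL_incl`, by `rfl`).

* `nonsingular_toX_toY`, `twistMapL_some` — `Φ(X, Y) = (θ⁻²X, θ⁻³Y)`; `twistMapL_bijective`;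
* ★ **`smul_twistMapL`** — SEMILINEARITY: `σ • Φ P = χ_θ(σ) • Φ (σ • P)` for every `σ ∈ Aut(L/F)` and every
  `P ∈ W^{(c)}(L)`, `χ_θ` any sign function of `θ` (`σ θ = χ_θ(σ) θ`); both actions are the tree's
  `instDistribMulActionAlgEquivPoint` (on `W^{(c)} ⊗ L` and on `W^{(1)} ⊗ L`);
* `two_nsmul_smul_sub_self_eq_zero` — the Kummer cocycle `σ ↦ σ • R^{tw} − R^{tw}` of a half of a RATIONAL point is
  `2`-torsion-valued; `smul_sub_self_eq_zero_iff` — it vanishes at `σ` iff `σ` fixes the half;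
* ★★ **`psi_eq_twistMapL_kummer`** — memo (ii): if `2 • R^{tw} = ι P₀` then
  `σ • Φ R^{tw} − χ_θ(σ) • Φ R^{tw} = Φ (σ • R^{tw} − R^{tw})`; `psi_eq_zero_iff_smul_twist_half_eq` — `ψ(σ) = 0 ⟺ σ`
  fixes `R^{tw}`; **`exists_twist_half`**, ★★ **`exists_psi_eq_twistMapL_kummer`** — for every `R ∈ W^{(1)}(L)` with
  `2 • R = τ P₀` there is `R^{tw} ∈ W^{(c)}(L)` with `Φ R^{tw} = R`, `2 • R^{tw} = ι P₀` and
  `ψ(σ) = Φ(σ • R^{tw} − R^{tw})` for all `σ`.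

Dictionary: `F = ℚ`, `L = K_gen`, `W^{(c)} = E^{(δ)}`, `W^{(1)} = E₀` (completed square), `P₀ = g_δ + t_δ`, `R^{tw} = φ_δ^{−1} R_δ`.
NOT here: the passage from the cocycle `σ ↦ σ • R^{tw} − R^{tw}` on `Aut(L/F)` to the class `κ^{(δ)}(P₀) ∈ H¹(ℚ, E[2]) =
(ℚ^×/ℚ^{×2})²` and its `2`-descent coordinates `(x − δe₁, x − δe₂)` (tree `TwoDescent.lean`, another file's business), and
any local symbol.  Everything is proved (no `sorry`, standard axioms); nothing here is a statement of the line, and NOTHING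
HERE PROVES R″ or any summit — BSD is not advanced by this file alone.

## References

* [SilvermanAEC2009] J. H. Silverman, *The Arithmetic of Elliptic Curves*, 2nd ed. (2009), VIII.§2 (Kummer pairing), X.2
  (proof of Prop. 2.4), X.5 Cor. 5.4, Exercise 10.16 (the twist over `F(√c)`).
* [Kramer1981] K. Kramer, *Arithmetic of elliptic curves upon quadratic extension*, Trans. AMS 264 (1981).
-/

noncomputable section

open scoped Classical

namespace Summit.BirchSwinnertonDyer.BirchSwinnertonDyer.Theorems.GenusKolyvaginAtTwo.FullVertex.PsiLaw

open WeierstrassCurve WeierstrassCurve.QuadraticDescent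
open Literature.NumberTheory.QuadraticFields.Quadratic (ne_zero_of_not_mem_range)

universe u

variable {F L : Type u} [Field F] [Field L] [Algebra F L]

/-! ## The Kummer cocycle of a half of a rational point -/

/-- **The Kummer cocycle of a half of a RATIONAL point is `2`-torsion-valued**: if `2 • R = ι P₀` with `P₀ ∈ V(F)`, then
`2 • (σ • R − R) = σ • ι P₀ − ι P₀ = O` for every `σ ∈ Aut(L/F)`. [cite: SilvermanAEC2009, VIII.§2] -/
theorem two_nsmul_smul_sub_self_eq_zero (V : WeierstrassCurve F) (P₀ : V.toAffine.Point)
    (R : (V.baseChange L).toAffine.Point) (hR : (2 : ℕ) • R = incl L V P₀) (σ : L ≃ₐ[F] L) :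
    (2 : ℕ) • (σ • R - R) = 0 := by
  have hfix : σ • incl L V P₀ = incl L V P₀ := by
    rw [WeierstrassCurve.smul_def]
    exact conjMap_incl V (σ : L →ₐ[F] L) P₀
  rw [smul_sub, smul_comm (2 : ℕ) σ R, hR, hfix, sub_self]

/-- The Kummer cocycle vanishes at `σ` iff `σ` fixes the half. [cite: SilvermanAEC2009, VIII.§2] -/
theorem smul_sub_self_eq_zero_iff (V : WeierstrassCurve F) (R : (V.baseChange L).toAffine.Point) (σ : L ≃ₐ[F] L) :
    σ • R - R = 0 ↔ σ • R = R :=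
  sub_eq_zero

variable [NeZero (2 : F)] (W : WeierstrassCurve F) {θ : L} {c : F}
  (hθ : θ ∉ Set.range (algebraMap F L)) (hc : θ ^ 2 = algebraMap F L c)

/-! ## The twisting isomorphism `Φ : W^{(c)}(L) → W^{(1)}(L)` on `L`-points -/

/-- The change of variables `u = θ` carries nonsingular points of `W^{(c)} ⊗ L` to nonsingular points of `W^{(1)} ⊗ L`:
`(X, Y) ↦ (θ⁻²X, θ⁻³Y)`. [cite: SilvermanAEC2009, X.5 Cor. 5.4] -/
theorem nonsingular_toX_toY (hc : θ ^ 2 = algebraMap F L c) {X Y : L} (hP : ((W.quadraticTwist c).baseChange L).toAffine.Nonsingular X Y) :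
    ((W.quadraticTwist 1).baseChange L).toAffine.Nonsingular ((twistUntwist hθ).toX X) ((twistUntwist hθ).toY X Y) := by
  rw [← twistUntwist_smul_baseChange W hθ hc, VariableChange.nonsingular_iff]
  exact hP

/-- **`Φ` on affine points**: `Φ(X, Y) = (θ⁻²X, θ⁻³Y)`, for `Φ` the composite
`congrEquiv ∘ pointEquiv (twistUntwist hθ)` (hypothesis `hΦ`, instantiate with `rfl`). [cite: SilvermanAEC2009, X.5 Cor. 5.4] -/
theorem twistMapL_some
    (Φ : ((W.quadraticTwist c).baseChange L).toAffine.Point →+ ((W.quadraticTwist 1).baseChange L).toAffine.Point)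
    (hΦ : Φ = (Affine.Point.congrEquiv (twistUntwist_smul_baseChange W hθ hc)).toAddMonoidHom.comp
      (VariableChange.pointEquiv ((W.quadraticTwist c).baseChange L) (twistUntwist hθ)).toAddMonoidHom)
    {X Y : L} (hP : ((W.quadraticTwist c).baseChange L).toAffine.Nonsingular X Y) :
    Φ (.some X Y hP)
      = .some ((twistUntwist hθ).toX X) ((twistUntwist hθ).toY X Y) (nonsingular_toX_toY W hθ hc hP) := by
  subst hΦ
  show Affine.Point.congrEquiv _ (VariableChange.pointEquiv _ _ (.some X Y hP)) = _
  rw [VariableChange.pointEquiv_some, Affine.Point.congrEquiv_some]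

/-- **`τ = Φ ∘ ι`**: the tree's twisting map on rational points is `Φ` after base change (by definition).
[cite: SilvermanAEC2009, Exercise 10.16] -/
theorem twistMap_eq_twistMapL_incl
    (Φ : ((W.quadraticTwist c).baseChange L).toAffine.Point →+ ((W.quadraticTwist 1).baseChange L).toAffine.Point)
    (hΦ : Φ = (Affine.Point.congrEquiv (twistUntwist_smul_baseChange W hθ hc)).toAddMonoidHom.comp
      (VariableChange.pointEquiv ((W.quadraticTwist c).baseChange L) (twistUntwist hθ)).toAddMonoidHom)
    (P : (W.quadraticTwist c).toAffine.Point) :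
    twistMap W hθ hc P = Φ (incl L (W.quadraticTwist c) P) := by
  subst hΦ
  rfl

/-- `Φ` is bijective (a composite of two group isomorphisms). [cite: SilvermanAEC2009, X.5 Cor. 5.4] -/
theorem twistMapL_bijective
    (Φ : ((W.quadraticTwist c).baseChange L).toAffine.Point →+ ((W.quadraticTwist 1).baseChange L).toAffine.Point)
    (hΦ : Φ = (Affine.Point.congrEquiv (twistUntwist_smul_baseChange W hθ hc)).toAddMonoidHom.comp
      (VariableChange.pointEquiv ((W.quadraticTwist c).baseChange L) (twistUntwist hθ)).toAddMonoidHom) :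
    Function.Bijective Φ := by
  subst hΦ
  simp only [AddMonoidHom.coe_comp, AddEquiv.toAddMonoidHom_eq_coe, AddMonoidHom.coe_coe]
  exact (AddEquiv.bijective _).comp (AddEquiv.bijective _)

/-- **SEMILINEARITY of the twisting isomorphism** (memo §2 (ii) «`ρR_δ = χ_δ(ρ)·φ_δ(ρR^{tw})`»): for `σ ∈ Aut(L/F)` with
`σ θ = χ(σ) θ` and every `P ∈ W^{(c)}(L)`, `σ • Φ P = χ(σ) • Φ (σ • P)` — on coordinates `σ(θ⁻²X) = θ⁻² σX` and
`σ(θ⁻³Y) = χ(σ) θ⁻³ σY`, while `−(x, y) = (x, −y)` on the completed-square model. [cite: SilvermanAEC2009, X.5 Cor. 5.4] -/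
theorem smul_twistMapL (χ : (L ≃ₐ[F] L) → ℤˣ) (hχ : ∀ σ : L ≃ₐ[F] L, σ θ = ((χ σ : ℤˣ) : ℤ) • θ)
    (Φ : ((W.quadraticTwist c).baseChange L).toAffine.Point →+ ((W.quadraticTwist 1).baseChange L).toAffine.Point)
    (hΦ : Φ = (Affine.Point.congrEquiv (twistUntwist_smul_baseChange W hθ hc)).toAddMonoidHom.comp
      (VariableChange.pointEquiv ((W.quadraticTwist c).baseChange L) (twistUntwist hθ)).toAddMonoidHom)
    (σ : L ≃ₐ[F] L) (P : ((W.quadraticTwist c).baseChange L).toAffine.Point) :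
    σ • Φ P = ((χ σ : ℤˣ) : ℤ) • Φ (σ • P) := by
  rcases P with _ | ⟨X, Y, hP⟩
  · rw [← Affine.Point.zero_def, smul_zero, map_zero, smul_zero, smul_zero]
  · rw [twistMapL_some W hθ hc Φ hΦ, WeierstrassCurve.smul_def (W.quadraticTwist 1) L σ, Affine.Point.map_some,
      WeierstrassCurve.smul_def (W.quadraticTwist c) L σ, Affine.Point.map_some, twistMapL_some W hθ hc Φ hΦ]
    rcases Int.units_eq_one_or (χ σ) with h1 | h1
    · have hσ : (σ : L →ₐ[F] L) θ = θ := by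
        have := hχ σ; rw [h1] at this; simpa using this
      rw [h1, Units.val_one, one_zsmul]
      simp only [VariableChange.toX_def, VariableChange.toY_def, twistUntwist, sub_zero, zero_mul, inv_pow,
        Units.val_inv_eq_inv_val, Units.val_mk0, map_mul, map_inv₀, map_pow, hσ]
    · have hσ : (σ : L →ₐ[F] L) θ = -θ := by
        have := hχ σ; rw [h1] at this; simpa using this
      rw [h1, Units.val_neg, Units.val_one, neg_one_zsmul, Affine.Point.neg_some]
      simp only [negY_quadraticTwist_one_baseChange, VariableChange.toX_def, VariableChange.toY_def, twistUntwist,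
        sub_zero, zero_mul, inv_pow, Units.val_inv_eq_inv_val, Units.val_mk0, map_mul, map_inv₀, map_pow, hσ,
        Even.neg_pow (by decide : Even 2), Odd.neg_pow (by decide : Odd 3), inv_neg, neg_mul]

/-! ## Memo §2 (ii): `ψ = Φ ∘ (Kummer cocycle of the twist half)` -/

/-- **IDENTIFICATION** (memo §2 (ii)).  If `R^{tw} ∈ W^{(c)}(L)` is a half of a RATIONAL point, `2 • R^{tw} = ι P₀`
(`P₀ = g_δ + t_δ ∈ E^{(δ)}(ℚ)`), then for `R := Φ R^{tw}`:  `σ • R − χ(σ) • R = Φ (σ • R^{tw} − R^{tw})` — the class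
`ψ_δ` of `…PsiLaw` is the transport by `φ_δ` of the Kummer cocycle of `P₀` on the twist. [cite: SilvermanAEC2009, VIII.§2]
[cite: SilvermanAEC2009, X.5 Cor. 5.4] -/
theorem psi_eq_twistMapL_kummer (χ : (L ≃ₐ[F] L) → ℤˣ) (hχ : ∀ σ : L ≃ₐ[F] L, σ θ = ((χ σ : ℤˣ) : ℤ) • θ)
    (Φ : ((W.quadraticTwist c).baseChange L).toAffine.Point →+ ((W.quadraticTwist 1).baseChange L).toAffine.Point)
    (hΦ : Φ = (Affine.Point.congrEquiv (twistUntwist_smul_baseChange W hθ hc)).toAddMonoidHom.comp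
      (VariableChange.pointEquiv ((W.quadraticTwist c).baseChange L) (twistUntwist hθ)).toAddMonoidHom)
    (P₀ : (W.quadraticTwist c).toAffine.Point) (Rtw : ((W.quadraticTwist c).baseChange L).toAffine.Point)
    (hRtw : (2 : ℕ) • Rtw = incl L (W.quadraticTwist c) P₀) (σ : L ≃ₐ[F] L) :
    σ • Φ Rtw - ((χ σ : ℤˣ) : ℤ) • Φ Rtw = Φ (σ • Rtw - Rtw) := by
  have h2 : (2 : ℕ) • Φ (σ • Rtw - Rtw) = 0 := by
    rw [← map_nsmul, two_nsmul_smul_sub_self_eq_zero (W.quadraticTwist c) P₀ Rtw hRtw σ, map_zero]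
  have hfix : ((χ σ : ℤˣ) : ℤ) • Φ (σ • Rtw - Rtw) = Φ (σ • Rtw - Rtw) := by
    rcases Int.units_eq_one_or (χ σ) with h1 | h1
    · rw [h1, Units.val_one, one_zsmul]
    · rw [h1, Units.val_neg, Units.val_one, neg_one_zsmul, neg_eq_iff_add_eq_zero, ← two_nsmul, h2]
  rw [smul_twistMapL W hθ hc χ hχ Φ hΦ σ Rtw, show σ • Rtw = (σ • Rtw - Rtw) + Rtw from by abel, map_add,
    smul_add, hfix]
  abel

/-- `ψ(σ) = 0 ⟺ σ` fixes the twist half `R^{tw}` (`Φ` is injective). [cite: SilvermanAEC2009, VIII.§2] -/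
theorem psi_eq_zero_iff_smul_twist_half_eq (χ : (L ≃ₐ[F] L) → ℤˣ)
    (hχ : ∀ σ : L ≃ₐ[F] L, σ θ = ((χ σ : ℤˣ) : ℤ) • θ)
    (Φ : ((W.quadraticTwist c).baseChange L).toAffine.Point →+ ((W.quadraticTwist 1).baseChange L).toAffine.Point)
    (hΦ : Φ = (Affine.Point.congrEquiv (twistUntwist_smul_baseChange W hθ hc)).toAddMonoidHom.comp
      (VariableChange.pointEquiv ((W.quadraticTwist c).baseChange L) (twistUntwist hθ)).toAddMonoidHom)
    (P₀ : (W.quadraticTwist c).toAffine.Point) (Rtw : ((W.quadraticTwist c).baseChange L).toAffine.Point)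
    (hRtw : (2 : ℕ) • Rtw = incl L (W.quadraticTwist c) P₀) (σ : L ≃ₐ[F] L) :
    σ • Φ Rtw - ((χ σ : ℤˣ) : ℤ) • Φ Rtw = 0 ↔ σ • Rtw = Rtw := by
  rw [psi_eq_twistMapL_kummer W hθ hc χ hχ Φ hΦ P₀ Rtw hRtw σ, ← sub_eq_zero (a := σ • Rtw),
    ← map_zero Φ]
  exact (twistMapL_bijective W hθ hc Φ hΦ).1.eq_iff

/-- **The twist half exists**: every `R ∈ W^{(1)}(L)` with `2 • R = τ P₀` is `Φ R^{tw}` for a (unique) `R^{tw} ∈ W^{(c)}(L)`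
with `2 • R^{tw} = ι P₀` (`Φ` bijective, `τ = Φ ∘ ι`). [cite: SilvermanAEC2009, Exercise 10.16] -/
theorem exists_twist_half
    (Φ : ((W.quadraticTwist c).baseChange L).toAffine.Point →+ ((W.quadraticTwist 1).baseChange L).toAffine.Point)
    (hΦ : Φ = (Affine.Point.congrEquiv (twistUntwist_smul_baseChange W hθ hc)).toAddMonoidHom.comp
      (VariableChange.pointEquiv ((W.quadraticTwist c).baseChange L) (twistUntwist hθ)).toAddMonoidHom)
    (P₀ : (W.quadraticTwist c).toAffine.Point) (R : ((W.quadraticTwist 1).baseChange L).toAffine.Point)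
    (hR : (2 : ℕ) • R = twistMap W hθ hc P₀) :
    ∃ Rtw : ((W.quadraticTwist c).baseChange L).toAffine.Point,
      Φ Rtw = R ∧ (2 : ℕ) • Rtw = incl L (W.quadraticTwist c) P₀ := by
  obtain ⟨Rtw, rfl⟩ := (twistMapL_bijective W hθ hc Φ hΦ).2 R
  refine ⟨Rtw, rfl, (twistMapL_bijective W hθ hc Φ hΦ).1 ?_⟩
  rw [map_nsmul, hR, twistMap_eq_twistMapL_incl W hθ hc Φ hΦ]

/-- ★★ **Memo §2 (ii), assembled.**  For every half `R ∈ W^{(1)}(L)` of a twist point, `2 • R = τ P₀` with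
`P₀ ∈ W^{(c)}(F)` (`= g_δ + t_δ`), there is `R^{tw} ∈ W^{(c)}(L)` with `Φ R^{tw} = R`, `2 • R^{tw} = ι P₀`, and
`ψ(σ) := σ • R − χ(σ) • R = Φ (σ • R^{tw} − R^{tw})` for EVERY `σ ∈ Aut(L/F)`: the Ψ-invariant of `…PsiLaw` is the
(transported) Kummer cocycle of the rational point `P₀` of the twist — a first-descent datum.
[cite: SilvermanAEC2009, VIII.§2] [cite: SilvermanAEC2009, Exercise 10.16] -/
theorem exists_psi_eq_twistMapL_kummer (χ : (L ≃ₐ[F] L) → ℤˣ)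
    (hχ : ∀ σ : L ≃ₐ[F] L, σ θ = ((χ σ : ℤˣ) : ℤ) • θ)
    (Φ : ((W.quadraticTwist c).baseChange L).toAffine.Point →+ ((W.quadraticTwist 1).baseChange L).toAffine.Point)
    (hΦ : Φ = (Affine.Point.congrEquiv (twistUntwist_smul_baseChange W hθ hc)).toAddMonoidHom.comp
      (VariableChange.pointEquiv ((W.quadraticTwist c).baseChange L) (twistUntwist hθ)).toAddMonoidHom)
    (P₀ : (W.quadraticTwist c).toAffine.Point) (R : ((W.quadraticTwist 1).baseChange L).toAffine.Point)
    (hR : (2 : ℕ) • R = twistMap W hθ hc P₀) :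
    ∃ Rtw : ((W.quadraticTwist c).baseChange L).toAffine.Point,
      Φ Rtw = R ∧ (2 : ℕ) • Rtw = incl L (W.quadraticTwist c) P₀ ∧
        ∀ σ : L ≃ₐ[F] L, σ • R - ((χ σ : ℤˣ) : ℤ) • R = Φ (σ • Rtw - Rtw) := by
  obtain ⟨Rtw, rfl, hRtw⟩ := exists_twist_half W hθ hc Φ hΦ P₀ R hR
  exact ⟨Rtw, rfl, hRtw, fun σ => psi_eq_twistMapL_kummer W hθ hc χ hχ Φ hΦ P₀ Rtw hRtw σ⟩

end Summit.BirchSwinnertonDyer.BirchSwinnertonDyer.Theorems.GenusKolyvaginAtTwo.FullVertex.PsiLaw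

end
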